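import Summits.QuantumFields.BalabanUV.T4Continuum.Support.AveragingDeficitCounting
import HarnessLib

/-!
# T⁴ programme, node NE3, route Π (Γ″) · γ4″ (file B0) — ℓ^∞ SHELL COUNTING ON `ℤ^d`
# `#{u ∈ A : |u − c|_∞ = s} ≤ 2d(2s+1)^{d−1}` and `Σ_{u∈A} (1 + |u−c|_∞∕2)^{−p} ≤ 2d·4^{d−1}(S+1)(1+S∕2)^{d−1−p}` (`p + 1 ≤ d`)

NE3 formalisation swarm `b2b-balaban-t4-ne3-formalise-*`, LEAF PROVER 04 (gen 8); the counting input of the Coulomb profile lemma of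
`NE3MajorantProfile` (γ4″ for leaf-02-g8's route Γ″, journal HOME/CLAIMS.log l.25119 ∕ l.25351).  The shell `{|u|_∞ = s}` is `box s 0 ∖ box (s−1) 0`
(the tree's ℓ^∞ cubes `T4AveragingDeficitWall.box`, `AveragingDeficitCounting.card_box_eq`), of cardinality `(2s+1)^d − (2s−1)^d ≤ 2d(2s+1)^{d−1}`
(`geom_sum₂_mul_of_ge`); against the profile `(1+s∕2)^{−p}` with `p ≤ d − 1` the shell sum is bounded WITHOUT real exponents via
`(2s+1)^{d−1}(1+s∕2)^{−p} ≤ 4^{d−1}(1+s∕2)^{d−1−p}`.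

CONTENT (all [folklore]; 0 sorry; one DATA def `linf` → async audit): `linf`, `linf_le_l1`, `mem_box_zero_iff`, **`card_shell_le`**, **`sum_linfProf_le`**.

HONEST: elementary counting; nothing about minimisers or NE3 is asserted; NE3 NOT proved; spine PROVED 0∕9; finite T⁴ rung (B)+1 — NOT infinite volume,
NOT mass gap, NOT BetaPertH, NOT Clay.  PLACEMENT: `Summits/QuantumFields/BalabanUV/` (cell rule).
-/

set_option autoImplicit false

open scoped BigOperators
open Finset

namespace Summit.QuantumFields.BalabanUV.T4Continuum.NE3ShellCount

open Literature.MathematicalPhysics.QuantumFieldTheory.Balaban1983to89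
open B7Prop1Explicit B7Prop2Explicit
open T4AveragingDeficitWall (box)
open AveragingDeficitCounting (mem_box_iff card_box_eq)

noncomputable section

variable {d : ℕ}

/-- The ℓ^∞ size of a lattice vector. [folklore] -/
def linf (u : Site d) : ℕ := Finset.univ.sup fun i => (u i).natAbs

/-- `linf ≤ l1`. [folklore] -/
theorem linf_le_l1 (u : Site d) : linf u ≤ l1 u := by
  unfold linf l1
  exact Finset.sup_le fun i _ => Finset.single_le_sum (f := fun j => (u j).natAbs) (fun _ _ => Nat.zero_le _) (mem_univ i)

/-- `u ∈ box R 0 ↔ linf u ≤ R`. [folklore] -/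
theorem mem_box_zero_iff {R : ℕ} {u : Site d} : u ∈ box R (0 : Site d) ↔ linf u ≤ R := by
  rw [mem_box_iff, linf, Finset.sup_le_iff]
  simp only [Pi.zero_apply, sub_zero, mem_univ, true_implies]
  constructor
  · intro h κ; have := h κ; rw [Int.abs_eq_natAbs] at this; exact_mod_cast this
  · intro h κ; rw [Int.abs_eq_natAbs]; exact_mod_cast h κ

/-- **THE ℓ^∞ SHELL COUNT**: `#{u ∈ A : linf (u − c) = s} ≤ 2d·(2s+1)^{d−1}` for `d ≥ 1` (the shell is `box s ∖ box (s−1)`, whose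
cardinality `(2s+1)^d − (2s−1)^d` is bounded through `geom_sum₂`). [folklore] -/
theorem card_shell_le (hd : 1 ≤ d) (A : Finset (Site d)) (c : Site d) (s : ℕ) :
    ((A.filter fun u => linf (u - c) = s).card : ℝ) ≤ 2 * d * (2 * (s : ℝ) + 1) ^ (d - 1) := by
  classical
  -- inject into the shell about the origin
  have hinj : (A.filter fun u => linf (u - c) = s).card ≤ ((box s (0 : Site d)).filter fun v => linf v = s).card := by
    have hmaps : Set.MapsTo (fun u : Site d => u - c) (A.filter fun u => linf (u - c) = s)
        ((box s (0 : Site d)).filter fun v => linf v = s) := by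
      intro u hu
      have hu' : u ∈ A.filter fun u => linf (u - c) = s := hu
      rw [Finset.mem_filter] at hu'
      have goal : u - c ∈ (box s (0 : Site d)).filter fun v => linf v = s := by
        rw [Finset.mem_filter, mem_box_zero_iff]; exact ⟨hu'.2.le, hu'.2⟩
      exact goal
    exact Finset.card_le_card_of_injOn (fun u => u - c) hmaps (fun u _ v _ h => by simpa using h)
  -- the shell about the origin
  have hshell : (((box s (0 : Site d)).filter fun v => linf v = s).card : ℝ) ≤ 2 * d * (2 * (s : ℝ) + 1) ^ (d - 1) := by
    rcases Nat.eq_zero_or_pos s with rfl | hs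
    · -- `s = 0`: the shell is inside `box 0 0`, one point
      have h1 : ((box 0 (0 : Site d)).filter fun v => linf v = 0).card ≤ 1 := by
        calc _ ≤ (box 0 (0 : Site d)).card := Finset.card_filter_le _ _
          _ = 1 := by rw [card_box_eq]; simp
      have hd' : (1 : ℝ) ≤ 2 * d * (2 * ((0 : ℕ) : ℝ) + 1) ^ (d - 1) := by
        have : (1 : ℝ) ≤ d := by exact_mod_cast hd
        simp only [Nat.cast_zero, mul_zero, zero_add, one_pow, mul_one]; linarith
      exact le_trans (by exact_mod_cast h1) hd'
    · -- `s ≥ 1`: shell ⊆ box s 0 \ box (s-1) 0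
      have hsub : box (s - 1) (0 : Site d) ⊆ box s 0 := by
        intro v hv; rw [mem_box_zero_iff] at hv ⊢; omega
      have hss : ((box s (0 : Site d)).filter fun v => linf v = s) ⊆ box s 0 \ box (s - 1) 0 := by
        intro v hv
        rw [Finset.mem_filter] at hv
        rw [Finset.mem_sdiff, mem_box_zero_iff, mem_box_zero_iff]
        omega
      have hcard : ((box s (0 : Site d)) \ box (s - 1) 0).card = (2 * s + 1) ^ d - (2 * (s - 1) + 1) ^ d := by
        rw [Finset.card_sdiff_of_subset hsub, card_box_eq, card_box_eq]
      have hnat : (2 * s + 1) ^ d - (2 * (s - 1) + 1) ^ d ≤ 2 * d * (2 * s + 1) ^ (d - 1) := by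
        have hle : 2 * (s - 1) + 1 ≤ 2 * s + 1 := by omega
        have hdiff : 2 * s + 1 - (2 * (s - 1) + 1) = 2 := by omega
        have hg := geom_sum₂_mul_of_ge hle d
        rw [hdiff] at hg
        rw [← hg]
        have hterm : ∀ i ∈ range d, (2 * s + 1) ^ i * (2 * (s - 1) + 1) ^ (d - 1 - i) ≤ (2 * s + 1) ^ (d - 1) := by
          intro i hi
          rw [Finset.mem_range] at hi
          calc (2 * s + 1) ^ i * (2 * (s - 1) + 1) ^ (d - 1 - i) ≤ (2 * s + 1) ^ i * (2 * s + 1) ^ (d - 1 - i) :=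
                Nat.mul_le_mul_left _ (Nat.pow_le_pow_left hle _)
            _ = (2 * s + 1) ^ (d - 1) := by rw [← pow_add]; congr 1; omega
        have hsum := Finset.sum_le_sum hterm
        rw [Finset.sum_const, Finset.card_range, smul_eq_mul] at hsum
        calc (∑ i ∈ range d, (2 * s + 1) ^ i * (2 * (s - 1) + 1) ^ (d - 1 - i)) * 2 ≤ (d * (2 * s + 1) ^ (d - 1)) * 2 :=
              Nat.mul_le_mul_right 2 hsum
          _ = 2 * d * (2 * s + 1) ^ (d - 1) := by ring
      calc (((box s (0 : Site d)).filter fun v => linf v = s).card : ℝ) ≤ (((box s (0 : Site d)) \ box (s - 1) 0).card : ℝ) := by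
            exact_mod_cast Finset.card_le_card hss
        _ ≤ ((2 * d * (2 * s + 1) ^ (d - 1) : ℕ) : ℝ) := by rw [hcard]; exact_mod_cast hnat
        _ = 2 * d * (2 * (s : ℝ) + 1) ^ (d - 1) := by push_cast; ring
  exact le_trans (by exact_mod_cast hinj) hshell

/-- **A SUM OF ℓ^∞-PROFILES OVER ANY FINITE SET NEAR THE CORNER**: if every `u ∈ A` has `linf (u − c) ≤ S` and `p + 1 ≤ d`, then
`Σ_{u∈A} (1 + linf(u−c)∕2)^{−p} ≤ 2d·4^{d−1}·(S+1)·(1 + S∕2)^{d−1−p}` (shell by shell). [folklore] -/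
theorem sum_linfProf_le (hd : 1 ≤ d) {p : ℕ} (hp : p + 1 ≤ d) (A : Finset (Site d)) (c : Site d) (S : ℕ)
    (hA : ∀ u ∈ A, linf (u - c) ≤ S) :
    ∑ u ∈ A, ((1 + (linf (u - c) : ℝ) / 2) ^ p)⁻¹ ≤ 2 * d * 4 ^ (d - 1) * ((S : ℝ) + 1) * (1 + (S : ℝ) / 2) ^ (d - 1 - p) := by
  classical
  have hmaps : ∀ u ∈ A, linf (u - c) ∈ range (S + 1) := fun u hu => Finset.mem_range.mpr (Nat.lt_succ_of_le (hA u hu))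
  rw [← Finset.sum_fiberwise_of_maps_to hmaps]
  have hfib : ∀ σ ∈ range (S + 1), ∑ u ∈ A.filter (fun u => linf (u - c) = σ), ((1 + (linf (u - c) : ℝ) / 2) ^ p)⁻¹
      ≤ 2 * d * 4 ^ (d - 1) * (1 + (S : ℝ) / 2) ^ (d - 1 - p) := by
    intro σ hσ
    rw [Finset.mem_range] at hσ
    have hval : ∀ u ∈ A.filter (fun u => linf (u - c) = σ), ((1 + (linf (u - c) : ℝ) / 2) ^ p)⁻¹ = ((1 + (σ : ℝ) / 2) ^ p)⁻¹ := by
      intro u hu; rw [Finset.mem_filter] at hu; rw [hu.2]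
    rw [Finset.sum_congr rfl hval, Finset.sum_const, nsmul_eq_mul]
    have hc := card_shell_le hd A c σ
    have hσ1 : (0 : ℝ) < (1 + (σ : ℝ) / 2) ^ p := by positivity
    -- `(2σ+1)^{d-1} ≤ 4^{d-1}(1+σ/2)^{d-1}` and `(1+σ/2)^{d-1}/(1+σ/2)^p = (1+σ/2)^{d-1-p} ≤ (1+S/2)^{d-1-p}`
    have h4 : (2 * (σ : ℝ) + 1) ^ (d - 1) ≤ (4 : ℝ) ^ (d - 1) * (1 + (σ : ℝ) / 2) ^ (d - 1) := by
      rw [← mul_pow]; exact pow_le_pow_left₀ (by positivity) (by linarith) _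
    have hsplit : (1 + (σ : ℝ) / 2) ^ (d - 1) = (1 + (σ : ℝ) / 2) ^ (d - 1 - p) * (1 + (σ : ℝ) / 2) ^ p := by
      rw [← pow_add]; congr 1; omega
    have hmono : (1 + (σ : ℝ) / 2) ^ (d - 1 - p) ≤ (1 + (S : ℝ) / 2) ^ (d - 1 - p) :=
      pow_le_pow_left₀ (by positivity) (by
        have hσS : (σ : ℝ) ≤ S := by exact_mod_cast (show σ ≤ S by omega)
        linarith) _
    calc ((A.filter (fun u => linf (u - c) = σ)).card : ℝ) * ((1 + (σ : ℝ) / 2) ^ p)⁻¹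
        ≤ (2 * d * (2 * (σ : ℝ) + 1) ^ (d - 1)) * ((1 + (σ : ℝ) / 2) ^ p)⁻¹ := mul_le_mul_of_nonneg_right hc (by positivity)
      _ ≤ (2 * d * ((4 : ℝ) ^ (d - 1) * (1 + (σ : ℝ) / 2) ^ (d - 1))) * ((1 + (σ : ℝ) / 2) ^ p)⁻¹ :=
          mul_le_mul_of_nonneg_right (mul_le_mul_of_nonneg_left h4 (by positivity)) (by positivity)
      _ = 2 * d * 4 ^ (d - 1) * (1 + (σ : ℝ) / 2) ^ (d - 1 - p) := by rw [hsplit]; field_simp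
      _ ≤ _ := mul_le_mul_of_nonneg_left hmono (by positivity)
  calc _ ≤ ∑ _σ ∈ range (S + 1), 2 * (d : ℝ) * 4 ^ (d - 1) * (1 + (S : ℝ) / 2) ^ (d - 1 - p) := Finset.sum_le_sum hfib
    _ = _ := by rw [Finset.sum_const, Finset.card_range, nsmul_eq_mul]; push_cast; ring


end

end Summit.QuantumFields.BalabanUV.T4Continuum.NE3ShellCount
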